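import Literature.Topology.Immersions.ProjBundleOrientation
import Literature.Topology.Immersions.NormalBundleOrientation
import Mathlib.Topology.VectorBundle.Basic
import Mathlib.Analysis.Complex.Basic
import HarnessLib

/-!
# An oriented plane bundle is a complex line bundle

Topic `Literature/Topology/Immersions`. For a rank-`2` projection-field bundle `E = E(P)` in
`M × ℝᵐ` (`ProjectionFieldBundle.lean`) with an orientation `o` (`ProjBundleOrientation.lean`),
rotation by `+90°` in every oriented fibre plane is a complex structure, i.e. `E` is a complex
LINE bundle (Milnor–Stasheff, *Characteristic Classes* (1974), §14 p. 155 ff.: an oriented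
`2`-plane bundle "can be given a complex structure", unique up to homotopy; Kirby, *The Topology
of 4-Manifolds* (1989), Ch. II p. 21: "`2`-plane bundles over `M` are classified by their Euler
class `e ∈ H²(M;ℤ)` … equivalently complex line bundles by `c₁`"). We realise this as a Mathlib
`VectorBundleCore ℂ M ℂ M` (`ProjBundle.lineCore`) built from ORIENTED ORTHONORMAL local frames
(Gram–Schmidt on the transported frames of the bundle charts, second vector sign-corrected by the
orientation): two such frames of the same oriented plane differ by a rotation, so the coordinate
changes are multiplications by unit complex numbers, hence `ℂ`-linear, and the cocycle identity
holds. This is the form in which the tree's characteristic-class theory of complex line bundles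
(`Literature/AlgebraicTopology/CharacteristicClasses/LineEulerClass.lean`: `eulerClass`) applies
to the normal bundle of an immersed oriented `4`-manifold in `ℝ⁶` (`NormalBundleOrientation.lean`).

* linear algebra: `frameOf u₁ u₂ : ℝ² →L ℝᵐ`; `expand_of_onPair` (ON expansion in a plane);
  `rotation_of_onPair` — two equally oriented ON pairs of a fibre differ by a rotation;
* frames: `gs₁ P x₀ x`, `gs₂ P x₀ x` (Gram–Schmidt of the chart frame), ON on the good set,
  `orientationOfFrame (frameOf gs₁ gs₂) = chartOrientation`;
* `ProjBundle.lineCore P o ho : VectorBundleCore ℂ M ℂ M` and its coordinate changes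
  `lineCoordChange` (multiplication by `⟪u¹₁, u⁰₁⟫ - i ⟪u¹₁, u⁰₂⟫`).

Everything here is proved; the definitions are data; no named facts.

## References

* J. Milnor, J. Stasheff, *Characteristic Classes* (1974), §2 pp. 14–16, §14 p. 155.
  [MilnorStasheff1974]
* R. C. Kirby, *The Topology of 4-Manifolds*, LNM 1374 (1989), Ch. II p. 21. [Kirby1989]
-/

open scoped Manifold ContDiff Topology RealInnerProductSpace ComplexConjugate
open Set Function Module Filter

noncomputable section

namespace Literature.Topology.Immersions

/-- Local notation: `𝔼 n` is the model Euclidean space `EuclideanSpace ℝ (Fin n)`. -/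
local notation "𝔼 " n:arg => EuclideanSpace ℝ (Fin n)

open Literature.Topology.FourManifolds (leftInv leftInv_apply_self apply_leftInv_of_mem_range
  contDiffAt_leftInv)

/-! ### Frames of a plane from two vectors -/

section Frames

variable {m : ℕ}

/-- **The frame `c ↦ c₀ u₁ + c₁ u₂ : ℝ² →L ℝᵐ`** spanned by two vectors. [folklore] -/
def frameOf (u₁ u₂ : 𝔼 m) : 𝔼 2 →L[ℝ] 𝔼 m :=
  (EuclideanSpace.proj (0 : Fin 2)).smulRight u₁ + (EuclideanSpace.proj (1 : Fin 2)).smulRight u₂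

/-- `frameOf u₁ u₂ c = c 0 • u₁ + c 1 • u₂`. [folklore] -/
@[simp] theorem frameOf_apply (u₁ u₂ : 𝔼 m) (c : 𝔼 2) :
    frameOf u₁ u₂ c = c 0 • u₁ + c 1 • u₂ := rfl

/-- The first frame vector. [folklore] -/
@[simp] theorem frameOf_single_zero (u₁ u₂ : 𝔼 m) :
    frameOf u₁ u₂ (EuclideanSpace.single 0 1) = u₁ := by
  simp [frameOf_apply]

/-- The second frame vector. [folklore] -/
@[simp] theorem frameOf_single_one (u₁ u₂ : 𝔼 m) :
    frameOf u₁ u₂ (EuclideanSpace.single 1 1) = u₂ := by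
  simp [frameOf_apply]

/-- The range of a frame is the span of its two vectors. [folklore] -/
theorem range_frameOf (u₁ u₂ : 𝔼 m) :
    LinearMap.range (frameOf u₁ u₂).toLinearMap = Submodule.span ℝ {u₁, u₂} := by
  apply le_antisymm
  · rintro _ ⟨c, rfl⟩
    show c 0 • u₁ + c 1 • u₂ ∈ Submodule.span ℝ {u₁, u₂}
    exact Submodule.add_mem _ (Submodule.smul_mem _ _ (Submodule.subset_span (by simp)))
      (Submodule.smul_mem _ _ (Submodule.subset_span (by simp)))
  · rw [Submodule.span_le]
    rintro w hw
    simp only [Set.mem_insert_iff, Set.mem_singleton_iff] at hw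
    rcases hw with rfl | rfl
    · exact ⟨EuclideanSpace.single 0 1, frameOf_single_zero _ _⟩
    · exact ⟨EuclideanSpace.single 1 1, frameOf_single_one _ _⟩

/-- **Orthonormal pairs.** [folklore] -/
def OnPair (u₁ u₂ : 𝔼 m) : Prop := ‖u₁‖ = 1 ∧ ‖u₂‖ = 1 ∧ ⟪u₁, u₂⟫ = 0

/-- An orthonormal pair is linearly independent, so its frame is injective. [folklore] -/
theorem OnPair.injective_frameOf {u₁ u₂ : 𝔼 m} (h : OnPair u₁ u₂) : Injective (frameOf u₁ u₂) := by
  refine (injective_iff_map_eq_zero _).2 fun c hc => ?_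
  rw [frameOf_apply] at hc
  have h0 : c 0 = 0 := by
    have := congrArg (fun w => ⟪u₁, w⟫) hc
    simp only [inner_add_right, inner_smul_right, real_inner_self_eq_norm_sq, h.1, h.2.2,
      inner_zero_right] at this
    simpa using this
  have h1 : c 1 = 0 := by
    have := congrArg (fun w => ⟪u₂, w⟫) hc
    simp only [inner_add_right, inner_smul_right, real_inner_self_eq_norm_sq, h.2.1,
      real_inner_comm u₁ u₂ ▸ h.2.2, inner_zero_right] at this
    simpa using this
  ext i
  fin_cases i
  · exact h0
  · exact h1

/-- An orthonormal pair in a plane `K` spans it: `range (frameOf u₁ u₂) = K`. [folklore] -/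
theorem OnPair.range_frameOf_eq {u₁ u₂ : 𝔼 m} (h : OnPair u₁ u₂) {K : Submodule ℝ (𝔼 m)}
    (hK : finrank ℝ K = 2) (h₁ : u₁ ∈ K) (h₂ : u₂ ∈ K) :
    LinearMap.range (frameOf u₁ u₂).toLinearMap = K := by
  apply Submodule.eq_of_le_of_finrank_eq
  · rw [range_frameOf, Submodule.span_le]
    rintro v hv
    simp only [Set.mem_insert_iff, Set.mem_singleton_iff] at hv
    rcases hv with rfl | rfl <;> assumption
  · rw [LinearMap.finrank_range_of_inj h.injective_frameOf, finrank_euclideanSpace_fin, hK]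

/-- **Orthonormal expansion in a plane**: if `u₁, u₂` is an orthonormal pair in a subspace `K`
of dimension `2`, every `w ∈ K` is `⟪u₁, w⟫ u₁ + ⟪u₂, w⟫ u₂`. [folklore] -/
theorem OnPair.expand {u₁ u₂ : 𝔼 m} (h : OnPair u₁ u₂) {K : Submodule ℝ (𝔼 m)}
    (hK : finrank ℝ K = 2) (h₁ : u₁ ∈ K) (h₂ : u₂ ∈ K) {w : 𝔼 m} (hw : w ∈ K) :
    w = ⟪u₁, w⟫ • u₁ + ⟪u₂, w⟫ • u₂ := by
  have hw' : w ∈ LinearMap.range (frameOf u₁ u₂).toLinearMap := by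
    rw [h.range_frameOf_eq hK h₁ h₂]; exact hw
  obtain ⟨c, rfl⟩ := hw'
  have hc : ((frameOf u₁ u₂ : 𝔼 2 →ₗ[ℝ] 𝔼 m) c : 𝔼 m) = c 0 • u₁ + c 1 • u₂ := rfl
  rw [hc]
  have e0 : ⟪u₁, c 0 • u₁ + c 1 • u₂⟫ = c 0 := by
    simp [inner_add_right, inner_smul_right, h.1, h.2.2]
  have e1 : ⟪u₂, c 0 • u₁ + c 1 • u₂⟫ = c 1 := by
    simp [inner_add_right, inner_smul_right, h.2.1, real_inner_comm u₁ u₂ ▸ h.2.2]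
  rw [e0, e1]

/-- The coordinate vector `(a, b) ∈ ℝ²`. [folklore] -/
def coord2 (a b : ℝ) : 𝔼 2 := EuclideanSpace.single 0 a + EuclideanSpace.single 1 b

/-- First coordinate of `coord2`. [folklore] -/
@[simp] theorem coord2_apply_zero (a b : ℝ) : coord2 a b 0 = a := by simp [coord2]

/-- Second coordinate of `coord2`. [folklore] -/
@[simp] theorem coord2_apply_one (a b : ℝ) : coord2 a b 1 = b := by simp [coord2]

/-- `frameOf u₁ u₂ (a, b) = a u₁ + b u₂`. [folklore] -/
theorem frameOf_coord2 (u₁ u₂ : 𝔼 m) (a b : ℝ) : frameOf u₁ u₂ (coord2 a b) = a • u₁ + b • u₂ := by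
  rw [frameOf_apply, coord2_apply_zero, coord2_apply_one]

end Frames

/-! ### Two equally oriented orthonormal pairs of a fibre differ by a rotation -/

namespace ProjBundle

variable {n m : ℕ} {M : Type*} [TopologicalSpace M] [ChartedSpace (𝔼 n) M] (P : ProjBundle n m 2 M)

/-- The fibres of a rank-`2` bundle are planes. [folklore] -/
theorem finrank_fibre_two (x : M) : finrank ℝ (P.fibre x) = 2 := P.finrank_range x

/-- **Rotation lemma**: two orthonormal pairs `(u₁, u₂)`, `(v₁, v₂)` of the fibre `E_x` defining
the same orientation satisfy `v₁ = a u₁ + b u₂`, `v₂ = -b u₁ + a u₂` (`a = ⟪u₁, v₁⟫`,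
`b = ⟪u₂, v₁⟫`), i.e. `⟪u₁, v₂⟫ = -⟪u₂, v₁⟫` and `⟪u₂, v₂⟫ = ⟪u₁, v₁⟫`. [folklore] -/
theorem rotation_of_onPair (x : M) {u₁ u₂ v₁ v₂ : 𝔼 m} (hu : OnPair u₁ u₂) (hv : OnPair v₁ v₂)
    (hu₁ : u₁ ∈ P.fibre x) (hu₂ : u₂ ∈ P.fibre x) (hv₁ : v₁ ∈ P.fibre x) (hv₂ : v₂ ∈ P.fibre x)
    (hor : P.orientationOfFrame (frameOf u₁ u₂) hu.injective_frameOf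
        (hu.range_frameOf_eq (P.finrank_fibre_two x) hu₁ hu₂) =
      P.orientationOfFrame (frameOf v₁ v₂) hv.injective_frameOf
        (hv.range_frameOf_eq (P.finrank_fibre_two x) hv₁ hv₂)) :
    ⟪u₁, v₂⟫ = -⟪u₂, v₁⟫ ∧ ⟪u₂, v₂⟫ = ⟪u₁, v₁⟫ := by
  set a := ⟪u₁, v₁⟫
  set b := ⟪u₂, v₁⟫
  set c := ⟪u₁, v₂⟫
  set d := ⟪u₂, v₂⟫
  have h2 := P.finrank_fibre_two x
  have ev₁ : v₁ = a • u₁ + b • u₂ := hu.expand h2 hu₁ hu₂ hv₁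
  have ev₂ : v₂ = c • u₁ + d • u₂ := hu.expand h2 hu₁ hu₂ hv₂
  -- orthonormality of `v` in the coordinates `a, b, c, d`
  have huu : ⟪u₂, u₁⟫ = 0 := by rw [real_inner_comm]; exact hu.2.2
  have n₁ : a ^ 2 + b ^ 2 = 1 := by
    have h : ⟪v₁, v₁⟫ = 1 := by rw [real_inner_self_eq_norm_sq, hv.1, one_pow]
    rw [ev₁] at h
    simp only [inner_add_left, inner_add_right, inner_smul_left, inner_smul_right,
      real_inner_self_eq_norm_sq, hu.1, hu.2.1, hu.2.2, huu, RCLike.conj_to_real] at h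
    nlinarith [h]
  have n₂ : c ^ 2 + d ^ 2 = 1 := by
    have h : ⟪v₂, v₂⟫ = 1 := by rw [real_inner_self_eq_norm_sq, hv.2.1, one_pow]
    rw [ev₂] at h
    simp only [inner_add_left, inner_add_right, inner_smul_left, inner_smul_right,
      real_inner_self_eq_norm_sq, hu.1, hu.2.1, hu.2.2, huu, RCLike.conj_to_real] at h
    nlinarith [h]
  have n₃ : a * c + b * d = 0 := by
    have h := hv.2.2
    rw [ev₁, ev₂] at h
    simp only [inner_add_left, inner_add_right, inner_smul_left, inner_smul_right,
      real_inner_self_eq_norm_sq, hu.1, hu.2.1, hu.2.2, huu, RCLike.conj_to_real] at h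
    nlinarith [h]
  -- the orientation condition: `det (frameTransition U V) = a d - b c > 0`
  have hdet : 0 < a * d - b * c := by
    have hpos := (P.orientationOfFrame_eq_iff_det_pos _ _ hu.injective_frameOf hv.injective_frameOf
      (hu.range_frameOf_eq h2 hu₁ hu₂) (hv.range_frameOf_eq h2 hv₁ hv₂)).1 hor
    rw [← det_stdMat, Matrix.det_fin_two] at hpos
    have e0 : frameTransition (frameOf u₁ u₂) (frameOf v₁ v₂) (EuclideanSpace.single 0 1) = coord2 a b := by
      show leftInv (frameOf u₁ u₂) (frameOf v₁ v₂ (EuclideanSpace.single 0 1)) = coord2 a b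
      rw [frameOf_single_zero, ev₁, ← frameOf_coord2, leftInv_apply_self hu.injective_frameOf]
    have e1 : frameTransition (frameOf u₁ u₂) (frameOf v₁ v₂) (EuclideanSpace.single 1 1) = coord2 c d := by
      show leftInv (frameOf u₁ u₂) (frameOf v₁ v₂ (EuclideanSpace.single 1 1)) = coord2 c d
      rw [frameOf_single_one, ev₂, ← frameOf_coord2, leftInv_apply_self hu.injective_frameOf]
    simp only [stdMat, Matrix.of_apply, e0, e1, coord2_apply_zero, coord2_apply_one] at hpos
    linarith
  -- algebra: `(ad - bc)² + (ac + bd)² = (a² + b²)(c² + d²) = 1`, so `ad - bc = 1`, so `c = -b`, `d = a`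
  have hsq : (a * d - b * c) ^ 2 = 1 := by nlinarith [n₁, n₂, n₃]
  have h1 : a * d - b * c = 1 := by nlinarith [hsq, hdet]
  have hzero : (c + b) ^ 2 + (d - a) ^ 2 = 0 := by nlinarith [n₁, n₂, h1]
  have hc : c + b = 0 := by nlinarith [hzero, sq_nonneg (c + b), sq_nonneg (d - a)]
  have hd : d - a = 0 := by nlinarith [hzero, sq_nonneg (c + b), sq_nonneg (d - a)]
  exact ⟨by linarith, by linarith⟩

/-! ### Gram–Schmidt frames of the bundle charts -/

/-- First column `a₁(x) = A_x e₀` of the chart frame at `x₀`. [folklore] -/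
def col₁ (x₀ x : M) : 𝔼 m := P.frameAt x₀ x (EuclideanSpace.single 0 1)

/-- Second column `a₂(x) = A_x e₁` of the chart frame at `x₀`. [folklore] -/
def col₂ (x₀ x : M) : 𝔼 m := P.frameAt x₀ x (EuclideanSpace.single 1 1)

/-- **First Gram–Schmidt vector** `u₁ = a₁ / ‖a₁‖`. [folklore] -/
def gs₁ (x₀ x : M) : 𝔼 m := ‖P.col₁ x₀ x‖⁻¹ • P.col₁ x₀ x

/-- The Gram–Schmidt residual `t = a₂ - ⟪u₁, a₂⟫ u₁`. [folklore] -/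
def gsRes (x₀ x : M) : 𝔼 m := P.col₂ x₀ x - ⟪P.gs₁ x₀ x, P.col₂ x₀ x⟫ • P.gs₁ x₀ x

/-- **Second Gram–Schmidt vector** `n₂ = t / ‖t‖`. [folklore] -/
def gs₂ (x₀ x : M) : 𝔼 m := ‖P.gsRes x₀ x‖⁻¹ • P.gsRes x₀ x

/-- The chart frame is `frameOf a₁ a₂`. [folklore] -/
theorem frameAt_eq_frameOf (x₀ x : M) : P.frameAt x₀ x = frameOf (P.col₁ x₀ x) (P.col₂ x₀ x) := by
  ext1 c
  rw [frameOf_apply, col₁, col₂, ← map_smul, ← map_smul, ← map_add]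
  congr 1
  simpa using ((EuclideanSpace.basisFun (Fin 2) ℝ).sum_repr c).symm

variable {P}

/-- On the good set the first column is nonzero. [folklore] -/
theorem col₁_ne_zero {x₀ x : M} (hx : x ∈ P.goodSet x₀) : P.col₁ x₀ x ≠ 0 := by
  intro h
  have := hx.2 (h.trans (map_zero (P.frameAt x₀ x)).symm)
  simpa using congrFun (congrArg (⇑) this) 0

/-- On the good set the Gram–Schmidt residual is nonzero. [folklore] -/
theorem gsRes_ne_zero {x₀ x : M} (hx : x ∈ P.goodSet x₀) : P.gsRes x₀ x ≠ 0 := by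
  intro h
  -- `a₂ = μ a₁` contradicts the injectivity of the frame
  set μ : ℝ := ⟪P.gs₁ x₀ x, P.col₂ x₀ x⟫ * ‖P.col₁ x₀ x‖⁻¹
  have h' : P.col₂ x₀ x = μ • P.col₁ x₀ x := by
    have := sub_eq_zero.1 h
    rw [this]
    show ⟪P.gs₁ x₀ x, P.col₂ x₀ x⟫ • (‖P.col₁ x₀ x‖⁻¹ • P.col₁ x₀ x) = μ • P.col₁ x₀ x
    rw [smul_smul]
  have hA : P.frameAt x₀ x (EuclideanSpace.single 1 1 - μ • EuclideanSpace.single 0 1) = 0 := by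
    rw [map_sub, map_smul]
    show P.col₂ x₀ x - μ • P.col₁ x₀ x = 0
    rw [h', sub_self]
  have := hx.2 (hA.trans (map_zero (P.frameAt x₀ x)).symm)
  have h1 := congrFun (congrArg (⇑) this) 1
  simp at h1

/-- `‖u₁‖ = 1` on the good set. [folklore] -/
theorem norm_gs₁ {x₀ x : M} (hx : x ∈ P.goodSet x₀) : ‖P.gs₁ x₀ x‖ = 1 := by
  rw [gs₁, norm_smul, norm_inv, norm_norm, inv_mul_cancel₀ (norm_ne_zero_iff.2 (col₁_ne_zero hx))]

/-- `‖n₂‖ = 1` on the good set. [folklore] -/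
theorem norm_gs₂ {x₀ x : M} (hx : x ∈ P.goodSet x₀) : ‖P.gs₂ x₀ x‖ = 1 := by
  rw [gs₂, norm_smul, norm_inv, norm_norm, inv_mul_cancel₀ (norm_ne_zero_iff.2 (gsRes_ne_zero hx))]

/-- `u₁ ⊥ t`. [folklore] -/
theorem inner_gs₁_gsRes {x₀ x : M} (hx : x ∈ P.goodSet x₀) : ⟪P.gs₁ x₀ x, P.gsRes x₀ x⟫ = 0 := by
  rw [gsRes, inner_sub_right, inner_smul_right, real_inner_self_eq_norm_sq, norm_gs₁ hx]
  ring

/-- `u₁ ⊥ n₂`. [folklore] -/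
theorem inner_gs₁_gs₂ {x₀ x : M} (hx : x ∈ P.goodSet x₀) : ⟪P.gs₁ x₀ x, P.gs₂ x₀ x⟫ = 0 := by
  rw [gs₂, inner_smul_right, inner_gs₁_gsRes hx, mul_zero]

/-- **The Gram–Schmidt pair is orthonormal** on the good set. [folklore] -/
theorem onPair_gs {x₀ x : M} (hx : x ∈ P.goodSet x₀) : OnPair (P.gs₁ x₀ x) (P.gs₂ x₀ x) :=
  ⟨norm_gs₁ hx, norm_gs₂ hx, inner_gs₁_gs₂ hx⟩

variable (P) in
/-- The columns lie in the fibre. [folklore] -/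
theorem col₁_mem (x₀ x : M) : P.col₁ x₀ x ∈ P.fibre x := P.frameAt_apply_mem x₀ x _

variable (P) in
/-- The columns lie in the fibre. [folklore] -/
theorem col₂_mem (x₀ x : M) : P.col₂ x₀ x ∈ P.fibre x := P.frameAt_apply_mem x₀ x _

variable (P) in
/-- `u₁ ∈ E_x`. [folklore] -/
theorem gs₁_mem (x₀ x : M) : P.gs₁ x₀ x ∈ P.fibre x := Submodule.smul_mem _ _ (P.col₁_mem x₀ x)

variable (P) in
/-- `t ∈ E_x`. [folklore] -/
theorem gsRes_mem (x₀ x : M) : P.gsRes x₀ x ∈ P.fibre x :=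
  Submodule.sub_mem _ (P.col₂_mem x₀ x) (Submodule.smul_mem _ _ (P.gs₁_mem x₀ x))

variable (P) in
/-- `n₂ ∈ E_x`. [folklore] -/
theorem gs₂_mem (x₀ x : M) : P.gs₂ x₀ x ∈ P.fibre x := Submodule.smul_mem _ _ (P.gsRes_mem x₀ x)

variable (P) in
/-- Continuity of the columns. [folklore] -/
theorem continuous_col₁ (x₀ : M) : Continuous (P.col₁ x₀) :=
  (P.continuous_frameAt x₀).clm_apply continuous_const

variable (P) in
/-- Continuity of the columns. [folklore] -/
theorem continuous_col₂ (x₀ : M) : Continuous (P.col₂ x₀) :=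
  (P.continuous_frameAt x₀).clm_apply continuous_const

variable (P) in
/-- **Continuity of `u₁`** on the good set. [folklore] -/
theorem continuousOn_gs₁ (x₀ : M) : ContinuousOn (P.gs₁ x₀) (P.goodSet x₀) :=
  ((continuous_norm.comp_continuousOn (P.continuous_col₁ x₀).continuousOn).inv₀
    fun _ hx => norm_ne_zero_iff.2 (col₁_ne_zero hx)).smul (P.continuous_col₁ x₀).continuousOn

variable (P) in
/-- Continuity of the residual on the good set. [folklore] -/
theorem continuousOn_gsRes (x₀ : M) : ContinuousOn (P.gsRes x₀) (P.goodSet x₀) := by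
  have h : ContinuousOn (fun x => ⟪P.gs₁ x₀ x, P.col₂ x₀ x⟫ • P.gs₁ x₀ x) (P.goodSet x₀) :=
    fun x hx => (ContinuousWithinAt.inner (𝕜 := ℝ) (P.continuousOn_gs₁ x₀ x hx)
      (P.continuous_col₂ x₀).continuousWithinAt).smul (P.continuousOn_gs₁ x₀ x hx)
  exact (P.continuous_col₂ x₀).continuousOn.sub h

variable (P) in
/-- **Continuity of `n₂`** on the good set. [folklore] -/
theorem continuousOn_gs₂ (x₀ : M) : ContinuousOn (P.gs₂ x₀) (P.goodSet x₀) :=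
  ((continuous_norm.comp_continuousOn (P.continuousOn_gsRes x₀)).inv₀
    fun _ hx => norm_ne_zero_iff.2 (gsRes_ne_zero hx)).smul (P.continuousOn_gsRes x₀)

/-- **Gram–Schmidt preserves the orientation**: the frame `(u₁, n₂)` defines the chart
orientation. [folklore] -/
theorem orientationOfFrame_gs {x₀ x : M} (hx : x ∈ P.goodSet x₀) :
    P.orientationOfFrame (frameOf (P.gs₁ x₀ x) (P.gs₂ x₀ x)) (onPair_gs hx).injective_frameOf
        ((onPair_gs hx).range_frameOf_eq (P.finrank_fibre_two x) (P.gs₁_mem x₀ x) (P.gs₂_mem x₀ x)) =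
      P.chartOrientation hx := by
  symm
  rw [chartOrientation, orientationOfFrame_eq_iff_det_pos, ← det_stdMat, Matrix.det_fin_two]
  -- the transition `leftInv A ∘ U` is upper triangular with positive diagonal
  set α : ℝ := ‖P.col₁ x₀ x‖⁻¹
  set β : ℝ := ‖P.gsRes x₀ x‖⁻¹
  set γ : ℝ := ⟪P.gs₁ x₀ x, P.col₂ x₀ x⟫
  have hα : 0 < α := inv_pos.2 (norm_pos_iff.2 (col₁_ne_zero hx))
  have hβ : 0 < β := inv_pos.2 (norm_pos_iff.2 (gsRes_ne_zero hx))
  have hu₁ : P.gs₁ x₀ x = P.frameAt x₀ x (coord2 α 0) := by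
    rw [frameAt_eq_frameOf, frameOf_coord2, zero_smul, add_zero]
    rfl
  have hu₂ : P.gs₂ x₀ x = P.frameAt x₀ x (coord2 (-(β * γ * α)) β) := by
    rw [frameAt_eq_frameOf, frameOf_coord2]
    show β • (P.col₂ x₀ x - γ • (α • P.col₁ x₀ x)) = _
    rw [smul_sub, smul_smul, smul_smul, neg_smul, sub_eq_add_neg, add_comm]
  have e0 : frameTransition (P.frameAt x₀ x) (frameOf (P.gs₁ x₀ x) (P.gs₂ x₀ x))
      (EuclideanSpace.single 0 1) = coord2 α 0 := by
    show leftInv (P.frameAt x₀ x) (frameOf (P.gs₁ x₀ x) (P.gs₂ x₀ x) (EuclideanSpace.single 0 1)) = _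
    rw [frameOf_single_zero, hu₁, leftInv_apply_self hx.2]
  have e1 : frameTransition (P.frameAt x₀ x) (frameOf (P.gs₁ x₀ x) (P.gs₂ x₀ x))
      (EuclideanSpace.single 1 1) = coord2 (-(β * γ * α)) β := by
    show leftInv (P.frameAt x₀ x) (frameOf (P.gs₁ x₀ x) (P.gs₂ x₀ x) (EuclideanSpace.single 1 1)) = _
    rw [frameOf_single_one, hu₂, leftInv_apply_self hx.2]
  simp only [stdMat, Matrix.of_apply, e0, e1, coord2_apply_zero, coord2_apply_one]
  nlinarith [mul_pos hα hβ]

/-! ### Oriented orthonormal frames -/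

section Oriented

variable (P) (o : ∀ x, Orientation ℝ (P.fibre x) (Fin 2))

/-- The sign correcting the chart frame at `x₀` to the orientation `o x₀`. [folklore] -/
def osign (x₀ : M) : ℝ := by
  classical
  exact if o x₀ = P.chartOrientation (P.mem_goodSet_self x₀) then 1 else -1

/-- **The second vector of the oriented orthonormal frame**: `u₂ = ± n₂`. [folklore] -/
def ogs₂ (x₀ x : M) : 𝔼 m := P.osign o x₀ • P.gs₂ x₀ x

/-- **The base set of the oriented chart at `x₀`**: the interior of the part of the good set
where `o` agrees with the chart orientation exactly as it does at `x₀`. [folklore] -/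
def obaseSet (x₀ : M) : Set M :=
  interior {x | ∃ hx : x ∈ P.goodSet x₀,
    (o x = P.chartOrientation hx ↔ o x₀ = P.chartOrientation (P.mem_goodSet_self x₀))}

/-- The base sets are open. [folklore] -/
theorem isOpen_obaseSet (x₀ : M) : IsOpen (P.obaseSet o x₀) := isOpen_interior

/-- The base set lies in the good set. [folklore] -/
theorem obaseSet_subset_goodSet (x₀ : M) : P.obaseSet o x₀ ⊆ P.goodSet x₀ :=
  fun _ hx => (interior_subset hx).1

variable {P o}

/-- On the base set, `o` agrees with the chart orientation as it does at `x₀`. [folklore] -/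
theorem iff_of_mem_obaseSet {x₀ x : M} (hx : x ∈ P.obaseSet o x₀) :
    (o x = P.chartOrientation (P.obaseSet_subset_goodSet o x₀ hx) ↔
      o x₀ = P.chartOrientation (P.mem_goodSet_self x₀)) :=
  (interior_subset hx).2

/-- **The base point lies in its base set** (this is where `o` being an orientation enters).
[folklore] -/
theorem mem_obaseSet_self (ho : P.IsOrientation o) (x₀ : M) : x₀ ∈ P.obaseSet o x₀ := by
  rw [obaseSet, mem_interior_iff_mem_nhds]
  filter_upwards [ho.eventually_iff x₀, (P.isOpen_goodSet x₀).mem_nhds (P.mem_goodSet_self x₀)]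
    with x hx hxg
  exact ⟨hxg, hx hxg⟩

/-- `osign = ±1`. [folklore] -/
theorem osign_sq (x₀ : M) : P.osign o x₀ * P.osign o x₀ = 1 := by
  classical
  unfold osign
  split_ifs <;> norm_num

/-- **The oriented frame is orthonormal** on the base set. [folklore] -/
theorem onPair_ogs {x₀ x : M} (hx : x ∈ P.obaseSet o x₀) : OnPair (P.gs₁ x₀ x) (P.ogs₂ o x₀ x) := by
  have hg := P.obaseSet_subset_goodSet o x₀ hx
  refine ⟨norm_gs₁ hg, ?_, ?_⟩
  · have hs : |P.osign o x₀| = 1 := by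
      classical
      unfold osign
      split_ifs <;> simp
    rw [ogs₂, norm_smul, Real.norm_eq_abs, hs, one_mul, norm_gs₂ hg]
  · rw [ogs₂, inner_smul_right, inner_gs₁_gs₂ hg, mul_zero]

variable (P o) in
/-- `u₂ ∈ E_x`. [folklore] -/
theorem ogs₂_mem (x₀ x : M) : P.ogs₂ o x₀ x ∈ P.fibre x := Submodule.smul_mem _ _ (P.gs₂_mem x₀ x)

variable (P o) in
/-- **Continuity of `u₂`** on the good set. [folklore] -/
theorem continuousOn_ogs₂ (x₀ : M) : ContinuousOn (P.ogs₂ o x₀) (P.goodSet x₀) :=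
  fun x hx => (continuousWithinAt_const (b := P.osign o x₀)).smul (P.continuousOn_gs₂ x₀ x hx)

/-- **The oriented frame defines the orientation `o x`** on the base set. [folklore] -/
theorem orientationOfFrame_ogs {x₀ x : M} (hx : x ∈ P.obaseSet o x₀) :
    P.orientationOfFrame (frameOf (P.gs₁ x₀ x) (P.ogs₂ o x₀ x)) (onPair_ogs hx).injective_frameOf
        ((onPair_ogs hx).range_frameOf_eq (P.finrank_fibre_two x) (P.gs₁_mem x₀ x)
          (P.ogs₂_mem o x₀ x)) = o x := by
  classical
  have hg := P.obaseSet_subset_goodSet o x₀ hx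
  have hiff := iff_of_mem_obaseSet hx
  have hgs := orientationOfFrame_gs hg
  by_cases h0 : o x₀ = P.chartOrientation (P.mem_goodSet_self x₀)
  · -- `osign = 1`: the oriented frame is the Gram–Schmidt frame
    have hs : P.osign o x₀ = 1 := by unfold osign; rw [if_pos h0]
    have hox : o x = P.chartOrientation hg := hiff.2 h0
    have hfr : frameOf (P.gs₁ x₀ x) (P.ogs₂ o x₀ x) = frameOf (P.gs₁ x₀ x) (P.gs₂ x₀ x) := by
      rw [ogs₂, hs, one_smul]
    rw [hox, ← hgs]
    -- same frame, proof-irrelevant data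
    have key : ∀ (A B : 𝔼 2 →L[ℝ] 𝔼 m) (hAB : A = B) (hA : Injective A) (hB : Injective B)
        (hrA : LinearMap.range A.toLinearMap = P.fibre x) (hrB : LinearMap.range B.toLinearMap = P.fibre x),
        P.orientationOfFrame A hA hrA = P.orientationOfFrame B hB hrB := by
      intro A B hAB hA hB hrA hrB
      subst hAB
      rfl
    exact key _ _ hfr _ _ _ _
  · -- `osign = -1`: the oriented frame is the Gram–Schmidt frame with the second vector reversed
    have hs : P.osign o x₀ = -1 := by unfold osign; rw [if_neg h0]
    have hox : o x ≠ P.chartOrientation hg := fun h => h0 (hiff.1 h)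
    have hox' : o x = -P.chartOrientation hg := by
      rcases (o x).eq_or_eq_neg (P.chartOrientation hg)
        (by rw [Fintype.card_fin]; exact (P.finrank_fibre_two x).symm) with h | h
      · exact absurd h hox
      · exact h
    rw [hox', ← hgs, eq_comm, P.neg_eq_iff_ne]
    -- the frames `(u₁, n₂)` and `(u₁, -n₂)` define opposite orientations: transition `diag(1, -1)`
    intro heq
    have hpos := (P.orientationOfFrame_eq_iff_det_pos _ _ (onPair_gs hg).injective_frameOf
      (onPair_ogs hx).injective_frameOf
      ((onPair_gs hg).range_frameOf_eq (P.finrank_fibre_two x) (P.gs₁_mem x₀ x) (P.gs₂_mem x₀ x))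
      ((onPair_ogs hx).range_frameOf_eq (P.finrank_fibre_two x) (P.gs₁_mem x₀ x)
        (P.ogs₂_mem o x₀ x))).1 heq
    rw [← det_stdMat, Matrix.det_fin_two] at hpos
    have e0 : frameTransition (frameOf (P.gs₁ x₀ x) (P.gs₂ x₀ x))
        (frameOf (P.gs₁ x₀ x) (P.ogs₂ o x₀ x)) (EuclideanSpace.single 0 1) = coord2 1 0 := by
      show leftInv (frameOf (P.gs₁ x₀ x) (P.gs₂ x₀ x))
        (frameOf (P.gs₁ x₀ x) (P.ogs₂ o x₀ x) (EuclideanSpace.single 0 1)) = _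
      rw [frameOf_single_zero, ← leftInv_apply_self (onPair_gs hg).injective_frameOf (coord2 1 0),
        frameOf_coord2, one_smul, zero_smul, add_zero]
    have e1 : frameTransition (frameOf (P.gs₁ x₀ x) (P.gs₂ x₀ x))
        (frameOf (P.gs₁ x₀ x) (P.ogs₂ o x₀ x)) (EuclideanSpace.single 1 1) = coord2 0 (-1) := by
      show leftInv (frameOf (P.gs₁ x₀ x) (P.gs₂ x₀ x))
        (frameOf (P.gs₁ x₀ x) (P.ogs₂ o x₀ x) (EuclideanSpace.single 1 1)) = _
      rw [frameOf_single_one, ← leftInv_apply_self (onPair_gs hg).injective_frameOf (coord2 0 (-1)),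
        frameOf_coord2, zero_smul, zero_add, ogs₂, hs]
    simp only [stdMat, Matrix.of_apply, e0, e1, coord2_apply_zero, coord2_apply_one] at hpos
    linarith

end Oriented

/-! ### The complex line bundle -/

section Line

open Complex

variable (P) (o : ∀ x, Orientation ℝ (P.fibre x) (Fin 2))

/-- The complex coordinate `κ_u(w) = ⟪u₁, w⟫ + i ⟪u₂, w⟫` of a vector in an orthonormal pair.
[folklore] -/
def cplxCoord (u₁ u₂ w : 𝔼 m) : ℂ := (⟪u₁, w⟫ : ℂ) + (⟪u₂, w⟫ : ℂ) * I

/-- **The transition coefficient** between the oriented frames of the charts at `x₀` and `x₁`,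
read at `x`: the unit complex number `⟪u¹₁, u⁰₁⟫ - i ⟪u¹₁, u⁰₂⟫`. [folklore] -/
def lineCoeff (x₀ x₁ x : M) : ℂ :=
  (⟪P.gs₁ x₁ x, P.gs₁ x₀ x⟫ : ℂ) - (⟪P.gs₁ x₁ x, P.ogs₂ o x₀ x⟫ : ℂ) * I

variable {P o}

/-- **Change of oriented orthonormal frame multiplies the complex coordinate by the transition
coefficient.** [folklore] -/
theorem cplxCoord_eq_lineCoeff_mul {x₀ x₁ x : M} (hx₀ : x ∈ P.obaseSet o x₀)
    (hx₁ : x ∈ P.obaseSet o x₁) (w : 𝔼 m) :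
    cplxCoord (P.gs₁ x₁ x) (P.ogs₂ o x₁ x) w =
      P.lineCoeff o x₀ x₁ x * cplxCoord (P.gs₁ x₀ x) (P.ogs₂ o x₀ x) w := by
  have hu := onPair_ogs hx₀
  have hv := onPair_ogs hx₁
  have h2 := P.finrank_fibre_two x
  -- both frames define `o x`, hence the same orientation: rotation lemma
  have hor : P.orientationOfFrame (frameOf (P.gs₁ x₀ x) (P.ogs₂ o x₀ x)) hu.injective_frameOf
        (hu.range_frameOf_eq h2 (P.gs₁_mem x₀ x) (P.ogs₂_mem o x₀ x)) =
      P.orientationOfFrame (frameOf (P.gs₁ x₁ x) (P.ogs₂ o x₁ x)) hv.injective_frameOf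
        (hv.range_frameOf_eq h2 (P.gs₁_mem x₁ x) (P.ogs₂_mem o x₁ x)) := by
    rw [orientationOfFrame_ogs hx₀, orientationOfFrame_ogs hx₁]
  obtain ⟨hc, hd⟩ := P.rotation_of_onPair x hu hv (P.gs₁_mem x₀ x) (P.ogs₂_mem o x₀ x)
    (P.gs₁_mem x₁ x) (P.ogs₂_mem o x₁ x) hor
  set a := ⟪P.gs₁ x₀ x, P.gs₁ x₁ x⟫
  set b := ⟪P.ogs₂ o x₀ x, P.gs₁ x₁ x⟫
  have ev₁ : P.gs₁ x₁ x = a • P.gs₁ x₀ x + b • P.ogs₂ o x₀ x :=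
    hu.expand h2 (P.gs₁_mem x₀ x) (P.ogs₂_mem o x₀ x) (P.gs₁_mem x₁ x)
  have ev₂ : P.ogs₂ o x₁ x = (-b) • P.gs₁ x₀ x + a • P.ogs₂ o x₀ x := by
    have h := hu.expand h2 (P.gs₁_mem x₀ x) (P.ogs₂_mem o x₀ x) (P.ogs₂_mem o x₁ x)
    rw [hc, hd] at h
    exact h
  have i₁ : ⟪P.gs₁ x₁ x, w⟫ = a * ⟪P.gs₁ x₀ x, w⟫ + b * ⟪P.ogs₂ o x₀ x, w⟫ := by
    conv_lhs => rw [ev₁]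
    rw [inner_add_left, inner_smul_left, inner_smul_left]
    simp
  have i₂ : ⟪P.ogs₂ o x₁ x, w⟫ = -b * ⟪P.gs₁ x₀ x, w⟫ + a * ⟪P.ogs₂ o x₀ x, w⟫ := by
    conv_lhs => rw [ev₂]
    rw [inner_add_left, inner_smul_left, inner_smul_left]
    simp
  have ha : ⟪P.gs₁ x₁ x, P.gs₁ x₀ x⟫ = a := real_inner_comm _ _
  have hb : ⟪P.gs₁ x₁ x, P.ogs₂ o x₀ x⟫ = b := real_inner_comm _ _
  apply Complex.ext
  · simp [cplxCoord, lineCoeff, i₁, ha, hb]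
  · simp [cplxCoord, lineCoeff, i₂, ha, hb]
    ring

/-- The complex coordinate of `u₁` in its own frame is `1`. [folklore] -/
theorem cplxCoord_self {x₀ x : M} (hx : x ∈ P.obaseSet o x₀) :
    cplxCoord (P.gs₁ x₀ x) (P.ogs₂ o x₀ x) (P.gs₁ x₀ x) = 1 := by
  have hu := onPair_ogs hx
  have h1 : ⟪P.gs₁ x₀ x, P.gs₁ x₀ x⟫ = 1 := by rw [real_inner_self_eq_norm_sq, hu.1, one_pow]
  have h2 : ⟪P.ogs₂ o x₀ x, P.gs₁ x₀ x⟫ = 0 := by rw [real_inner_comm]; exact hu.2.2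
  rw [cplxCoord, h1, h2]
  simp

/-- The transition coefficient from a chart to itself is `1`. [folklore] -/
theorem lineCoeff_self {x₀ x : M} (hx : x ∈ P.obaseSet o x₀) : P.lineCoeff o x₀ x₀ x = 1 := by
  have hu := onPair_ogs hx
  have h1 : ⟪P.gs₁ x₀ x, P.gs₁ x₀ x⟫ = 1 := by rw [real_inner_self_eq_norm_sq, hu.1, one_pow]
  rw [lineCoeff, h1, hu.2.2]
  simp

/-- **The cocycle identity** of the transition coefficients. [folklore] -/
theorem lineCoeff_comp {x₀ x₁ x₂ x : M} (hx₀ : x ∈ P.obaseSet o x₀) (hx₁ : x ∈ P.obaseSet o x₁)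
    (hx₂ : x ∈ P.obaseSet o x₂) :
    P.lineCoeff o x₁ x₂ x * P.lineCoeff o x₀ x₁ x = P.lineCoeff o x₀ x₂ x := by
  have h02 := cplxCoord_eq_lineCoeff_mul hx₀ hx₂ (P.gs₁ x₀ x)
  have h01 := cplxCoord_eq_lineCoeff_mul hx₀ hx₁ (P.gs₁ x₀ x)
  have h12 := cplxCoord_eq_lineCoeff_mul hx₁ hx₂ (P.gs₁ x₀ x)
  rw [cplxCoord_self hx₀, mul_one] at h02 h01
  rw [h01] at h12
  rw [← h02, h12]

variable (P o) in
/-- Continuity of the transition coefficient on the overlap of good sets. [folklore] -/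
theorem continuousOn_lineCoeff (x₀ x₁ : M) :
    ContinuousOn (P.lineCoeff o x₀ x₁) (P.goodSet x₀ ∩ P.goodSet x₁) := by
  have h1 : ContinuousOn (fun x => ⟪P.gs₁ x₁ x, P.gs₁ x₀ x⟫) (P.goodSet x₀ ∩ P.goodSet x₁) :=
    fun x hx => ContinuousWithinAt.inner (𝕜 := ℝ)
      ((P.continuousOn_gs₁ x₁).mono inter_subset_right x hx)
      ((P.continuousOn_gs₁ x₀).mono inter_subset_left x hx)
  have h2 : ContinuousOn (fun x => ⟪P.gs₁ x₁ x, P.ogs₂ o x₀ x⟫) (P.goodSet x₀ ∩ P.goodSet x₁) :=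
    fun x hx => ContinuousWithinAt.inner (𝕜 := ℝ)
      ((P.continuousOn_gs₁ x₁).mono inter_subset_right x hx)
      ((P.continuousOn_ogs₂ o x₀).mono inter_subset_left x hx)
  exact (continuous_ofReal.comp_continuousOn h1).sub
    ((continuous_ofReal.comp_continuousOn h2).mul continuousOn_const)

variable (P o)

/-- **The complex line bundle core of an oriented plane bundle**: charts indexed by base
points, base sets the oriented base sets, coordinate changes multiplication by the unit complex
transition coefficients. [cite: MilnorStasheff1974, §14 p. 155; Kirby1989, Ch. II p. 21] -/
def lineCore (ho : P.IsOrientation o) : VectorBundleCore ℂ M ℂ M where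
  baseSet x₀ := P.obaseSet o x₀
  isOpen_baseSet x₀ := P.isOpen_obaseSet o x₀
  indexAt x := x
  mem_baseSet_at x := mem_obaseSet_self ho x
  coordChange x₀ x₁ x := P.lineCoeff o x₀ x₁ x • ContinuousLinearMap.id ℂ ℂ
  coordChange_self x₀ x hx v := by
    show P.lineCoeff o x₀ x₀ x • v = v
    rw [lineCoeff_self hx, one_smul]
  continuousOn_coordChange x₀ x₁ :=
    ((P.continuousOn_lineCoeff o x₀ x₁).mono (inter_subset_inter (P.obaseSet_subset_goodSet o x₀)
      (P.obaseSet_subset_goodSet o x₁))).smul continuousOn_const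
  coordChange_comp x₀ x₁ x₂ x hx v := by
    show P.lineCoeff o x₁ x₂ x • (P.lineCoeff o x₀ x₁ x • v) = P.lineCoeff o x₀ x₂ x • v
    rw [smul_smul, lineCoeff_comp hx.1.1 hx.1.2 hx.2]

/-- The base sets of the line core. [folklore] -/
@[simp] theorem lineCore_baseSet (ho : P.IsOrientation o) (x₀ : M) :
    (P.lineCore o ho).baseSet x₀ = P.obaseSet o x₀ := rfl

/-- The coordinate changes of the line core are multiplications by the transition coefficients.
[folklore] -/
theorem lineCore_coordChange (ho : P.IsOrientation o) (x₀ x₁ x : M) (v : ℂ) :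
    (P.lineCore o ho).coordChange x₀ x₁ x v = P.lineCoeff o x₀ x₁ x * v := rfl

end Line

end ProjBundle

end Literature.Topology.Immersions
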